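import Summits.ValiantsHypothesis.ValiantsHypothesis.Theorems.TwoProducts.RankThreeAffineToricWronskianAssign

/-!
# Toric Wronskians of monomials, part 16: the POLARISED located coefficient of a MIXED word, classes of size ≤ 2 ((L1′)₂; (2b-ii)b of val-idea-crit-8 g6 #128/#130)

Sequel of ✓ `…ToricWronskianAssign` (word analysis) and ✓ `…ToricWronskianLetters` (`det_toricWNewt_nodes`).  ★★★ `toricW_mixed_word`: for class data
`e_i = b_i + n_i•q` with EVERY CLASS OF SIZE ≤ 2 (`ℓ_i ≤ 1` — every resonant vertex of the `m = 1` box `{1, x, y, xy}`), `v ∈ supp u` on the line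
`det(q,·) = 0`, off-line letters `p_i` on the rank-1 columns with `det(p_i, v) ≠ 0`, `m + d = N` (`d = toricWDefect b = #rank-1 columns`), and
`supp u` ADDITIVELY INDEPENDENT up to `N` letters (✓ `AddIndep`, hypothesis shape):
`coeff_{Σe + m•v + Σ_{ℓ_i=1} p_i} W_{J(·,u)}(X^e) = [Π_{j<i, j∼i}(n_i − n_j)] · Σ_{f ∈ toricWAssign ℓ p} [Π_{ℓ_i=1} u_{f i}·det(q, f i)] · Π_i Π_{j<i, j≁i}(z^f_i − z^f_j)`,
`z^f_i = toricWZ u v b f i = u_v·det(b_i, v) + [ℓ_i = 1]·u_v·det(f i, v)` — the POLARISATION over letter assignments of ✓ `toricW_layer_closed_form`'s hybrid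
Vandermonde (W4b = the pure word `p_i ≡ p`, one assignment); val-idea-crit-8 g6 merge memo rev D/E (L1′): at the (2,2) vertex this is the Markov form
`y_a y_b (y_a² − 3 y_a y_b + y_b² + 1)` whose zeros are the consecutive odd Fibonacci heights — the DEAD MIXED WORDS that LV-2 consumes.  Numerics: `l1prime_check2.py`
72/72 exact off additive coincidences (the sum over permutations = the sum over assignments for distinct letters).
ROUTE: `W = X^{Σe}·det 𝕄″·det Tⁿ` (✓ `toricW_eq_monomial_mul_det`, ✓ `toricWClassMat_eq_mul`, ✓ `det_toricWTri`); `det 𝕄″ = Σ_σ sgn Π_i 𝕄″_{σi,i}` and ✓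
`coeff_prod_eq_sum_assign` per permutation; the factors are `β^k` / `toricWLead β γ_{f i} κ_{f i} k 1` (✓ `coeff_toricWNewtMat_rank_zero/one`); `Σ_σ` reassembles
`det H_f`, `H_f = diag-scaled Newton matrix at the nodes z^f` (`toricWNodes_zero_of_rank_one`, ✓ `toricWNewt_congr`), and ✓ `det_toricWNewt_nodes` gives the
cross-class Vandermonde (in-class injectivity = `u_v·det(f i, v) ≠ 0`).  HONEST SCOPE (#128 (3)): a located cell AT a merge under a typed, inhabited, flagged
genericity hypothesis; `AddIndep` FAILS in the OLM slot; progress on `ConeTopBound`'s `R` = 0 until AddIndep is removed (LV-2).  HONEST LABEL: GP-scoped located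
cell on the OPEN rung 3-AFF (side ladder, crux `stmt-ValiantsHypothesis-5906` `TwoProducts`); `ConeTopBound`-uniform, `OLMLaw`, `RankThreeAffineLaw(Exp)`,
`TwoProducts`, PCB, `ResidualLawV25` UNMOVED; 0 summit distance; VP ≠ VNP is NOT proved; no summit statement is proved here.
`--supports stmt-ValiantsHypothesis-5906 --as helper` (val-port-4 g6; critic of record val-idea-crit-8 g6).  One data def with parameters (`toricWZ`); no Prop-defs,
no instances, no notation, no named facts. [folklore]
-/

noncomputable section
set_option linter.dupNamespace false

namespace Summit.ValiantsHypothesis.ValiantsHypothesis.Theorems.TwoProducts.RankTwoJacobian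

open scoped BigOperators
open MvPolynomial
open Literature.LinearAlgebra.Matrix (wronskianMatrix wronskian wronskianMatrix_apply wronskian_def)

section TowerKernel
open scoped Classical

/-! ### §3 The polarised located coefficient (classes of size ≤ 2) -/

/-- the HEIGHT DATA of an assignment: `z^f_i = β_i + [ℓ_i = 1]·γ_{f i}` (`β_i = u_v det(b_i, v)`, `γ_p = u_v det(p, v)`). [folklore] -/
def toricWZ (u : Poly2) (v : Expo) {K : ℕ} (b : Fin K → Expo) (f : Fin K → Expo) (i : Fin K) : ℂ :=
  coeff v u * ((idet (b i) v : ℤ) : ℂ) + (if toricWRank b i = 1 then coeff v u * ((idet (f i) v : ℤ) : ℂ) else 0)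

/-- with classes of size ≤ 2, the class of a rank-1 column `i` has exactly one rank-0 member, and its node-0 value is `x` there. [folklore] -/
theorem toricWNodes_zero_of_rank_one {K : ℕ} (b : Fin K → Expo) (x : Fin K → ℂ) (i : Fin K) (hi : toricWRank b i = 1) : ∃ j : Fin K, j < i ∧ b j = b i ∧ toricWRank b j = 0 ∧ toricWNodes b x (b i) 0 = x j := by
  -- a class member below `i` exists since `ℓ_i = 1`
  have hne : ((Finset.univ : Finset (Fin K)).filter fun j => j < i ∧ b j = b i).Nonempty := by
    rw [← Finset.card_pos]; unfold toricWRank at hi; rw [hi]; exact Nat.one_pos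
  obtain ⟨j, hj⟩ := hne
  obtain ⟨hji, hbj⟩ := (Finset.mem_filter.mp hj).2
  have hrj : toricWRank b j = 0 := by have := toricWRank_lt_of_lt b hji hbj; rw [hi] at this; omega
  refine ⟨j, hji, hbj, hrj, ?_⟩
  rw [← hbj, ← hrj, toricWNodes_rank]

/-- ★★★ **(L1′)₂ — THE POLARISED LOCATED COEFFICIENT OF A MIXED WORD, classes of size ≤ 2.**  Class data `e_i = b_i + n_i•q` with every class of size
`≤ 2` (`ℓ_i ≤ 1`; every resonant vertex of the `m = 1` box), `v ∈ supp u` on the line `det(q,·) = 0`, off-line letters `p_i` attached to the rank-1 columns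
(`d = toricWDefect b` of them), `m + d = N`, and `supp u` additively independent up to `N` letters.  Then the coefficient of `W_{J(·,u)}(X^e)` at the MIXED word
`Σe + m•v + Σ_{ℓ_i = 1} p_i` is
`[Π_{j<i, j∼i} (n_i − n_j)] · Σ_{f ∈ assignments} [Π_{ℓ_i=1} u_{f i}·det(q, f i)] · Π_i Π_{j<i, j≁i} (z^f_i − z^f_j)`,  `z^f_i = u_v det(b_i,v) + [ℓ_i=1]·u_v det(f i, v)`
— the POLARISATION of ✓ `toricW_layer_closed_form`'s hybrid Vandermonde over the assignments of the letters to the doubleton classes (val-idea-crit-8 g6 memo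
rev D: at the (2,2) vertex the Markov form; numerics `l1prime_check2.py` 72/72 off coincidences).  HONEST SCOPE: GP-scoped (AddIndep) located cell AT a merge;
`AddIndep` fails in the OLM slot; progress on `ConeTopBound`'s `R` = 0. -/
theorem toricW_mixed_word {u : Poly2} {v q : Expo} {N : ℕ} (hA : AddIndep u.support N) (hv : v ∈ u.support) (hqv : idet q v = 0)
    {K : ℕ} (e b : Fin K → Expo) (n : Fin K → ℕ) (he : ∀ i, e i = b i + n i • q) (hrank : ∀ i, toricWRank b i ≤ 1)
    (p : Fin K → Expo) (hp : ∀ i, toricWRank b i = 1 → p i ∈ u.support ∧ idet q (p i) ≠ 0) (hpv : ∀ i, toricWRank b i = 1 → idet (p i) v ≠ 0)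
    {m : ℕ} (hm : m + toricWDefect b = ∑ i : Fin K, (i : ℕ)) (hN : ∑ i : Fin K, (i : ℕ) ≤ N) :
    coeff ((∑ i, e i) + m • v + ∑ i ∈ (Finset.univ : Finset (Fin K)).filter (fun j => toricWRank b j = 1), p i)
        (wronskian (⇑(jacDer u)) (fun i => monomial (e i) (1 : ℂ))) =
      (∏ i : Fin K, ∏ j ∈ (Finset.univ : Finset (Fin K)).filter (fun j => j < i ∧ b j = b i), (((n i : ℕ) : ℂ) - ((n j : ℕ) : ℂ))) *
        ∑ f ∈ toricWAssign (toricWRank b) p,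
          (∏ i ∈ (Finset.univ : Finset (Fin K)).filter (fun j => toricWRank b j = 1), coeff (f i) u * ((idet q (f i) : ℤ) : ℂ)) *
            ∏ i : Fin K, ∏ j ∈ (Finset.univ : Finset (Fin K)).filter (fun j => j < i ∧ b j ≠ b i), (toricWZ u v b f i - toricWZ u v b f j) := by
  set R1 : Finset (Fin K) := Finset.univ.filter fun j => toricWRank b j = 1 with hR1
  set Z : Expo := m • v + ∑ i ∈ R1, p i with hZ
  have huv : coeff v u ≠ 0 := MvPolynomial.mem_support_iff.mp hv
  -- ranks: `Σ ℓ = d = |R1|`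
  have hr01 : ∀ i, toricWRank b i = 0 ∨ toricWRank b i = 1 := fun i => by have := hrank i; omega
  have hsumr : ∑ i, toricWRank b i = R1.card := by
    rw [hR1, Finset.card_filter]
    exact Finset.sum_congr rfl fun i _ => by rcases hr01 i with h | h <;> simp [h]
  have hdR : toricWDefect b = R1.card := by rw [← sum_toricWRank, hsumr]
  -- letters of an assignment are letters of `p`
  have hfl : ∀ f ∈ toricWAssign (toricWRank b) p, ∀ i, toricWRank b i = 1 → f i ∈ u.support ∧ idet q (f i) ≠ 0 ∧ idet (f i) v ≠ 0 := by
    intro f hf i hi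
    obtain ⟨hpi, -⟩ := Finset.mem_filter.mp hf
    have h := Fintype.mem_piFinset.mp hpi i
    rw [if_pos hi, Finset.mem_image] at h
    obtain ⟨j, hj, hfj⟩ := h
    have hj1 : toricWRank b j = 1 := (Finset.mem_filter.mp hj).2
    rw [← hfj]
    exact ⟨(hp j hj1).1, (hp j hj1).2, hpv j hj1⟩
  -- (A) `coeff = coeff_{Z} det 𝕄″ · det Tⁿ`
  have hA' : coeff ((∑ i, e i) + m • v + ∑ i ∈ R1, p i) (wronskian (⇑(jacDer u)) (fun i => monomial (e i) (1 : ℂ))) =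
      coeff Z (toricWNewtMat u q b n).det * (toricWTri b (fun i => ((n i : ℕ) : ℂ))).det := by
    rw [toricW_eq_monomial_mul_det u q e b n he, toricWClassMat_eq_mul, Matrix.det_mul, add_assoc, coeff_monomial_mul, one_mul,
      ← RingHom.mapMatrix_apply, ← RingHom.map_det, mul_comm, coeff_C_mul, mul_comm]
  rw [hA', det_toricWTri, mul_comm]
  congr 1
  -- (B) the determinant, permutation by permutation, through the word analysis
  rw [Matrix.det_apply, coeff_sum]
  have hσ : ∀ σ : Equiv.Perm (Fin K), coeff Z (Equiv.Perm.sign σ • ∏ i, toricWNewtMat u q b n (σ i) i) =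
      Equiv.Perm.sign σ • ∑ f ∈ toricWAssign (toricWRank b) p,
        ∏ i, coeff (toricWDecomp (fun i => ((σ i : Fin K) : ℕ)) (toricWRank b) v f i) (toricWNewtMat u q b n (σ i) i) := by
    intro σ
    rw [coeff_units_smul]
    congr 1
    have hmσ : m + R1.card = ∑ i, ((σ i : Fin K) : ℕ) := by rw [Equiv.sum_comp σ (fun i : Fin K => (i : ℕ)), ← hdR, hm]
    have hNσ : ∑ i, ((σ i : Fin K) : ℕ) ≤ N := by rw [Equiv.sum_comp σ (fun i : Fin K => (i : ℕ))]; exact hN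
    exact coeff_prod_eq_sum_assign hA hv hqv (fun i => ((σ i : Fin K) : ℕ)) (toricWRank b) hrank (fun i => toricWNewtMat u q b n (σ i) i)
      (fun i => isWordSupp_toricWNewtMat u q b n (σ i) i) p hp hmσ hNσ
  simp_rw [hσ]
  -- (C) the factors: rank-0 columns `β^k`, rank-1 columns `toricWLead β γ_{f i} κ_{f i} k 1`
  set H : (Fin K → Expo) → Matrix (Fin K) (Fin K) ℂ := fun f => Matrix.of fun k i =>
    if toricWRank b i = 1 then toricWLead (coeff v u * ((idet (b i) v : ℤ) : ℂ)) (coeff v u * ((idet (f i) v : ℤ) : ℂ))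
      (coeff (f i) u * ((idet q (f i) : ℤ) : ℂ)) k 1 else (coeff v u * ((idet (b i) v : ℤ) : ℂ)) ^ (k : ℕ) with hH
  have hval : ∀ f ∈ toricWAssign (toricWRank b) p, ∀ σ : Equiv.Perm (Fin K), ∀ i,
      coeff (toricWDecomp (fun i => ((σ i : Fin K) : ℕ)) (toricWRank b) v f i) (toricWNewtMat u q b n (σ i) i) = H f (σ i) i := by
    intro f hf σ i
    have hkN : ((σ i : Fin K) : ℕ) ≤ N :=
      (Finset.single_le_sum (f := fun j : Fin K => (j : ℕ)) (fun _ _ => Nat.zero_le _) (Finset.mem_univ (σ i))).trans hN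
    simp only [hH, Matrix.of_apply]
    unfold toricWDecomp
    rcases hr01 i with h0 | h1
    · rw [if_neg (by omega), if_neg (by omega), h0, Nat.sub_zero, add_zero]
      exact coeff_toricWNewtMat_rank_zero hA hv hqv b n (σ i) i hkN h0
    · rw [if_pos h1, if_pos h1, h1]
      obtain ⟨hfs, hfq, -⟩ := hfl f hf i h1
      exact coeff_toricWNewtMat_rank_one hA hv hqv b n (σ i) i hkN h1 hfs hfq
  rw [Finset.sum_congr rfl fun σ _ => by rw [Finset.smul_sum], Finset.sum_comm]
  refine Finset.sum_congr rfl fun f hf => ?_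
  rw [Finset.sum_congr rfl fun σ _ => by rw [Finset.prod_congr rfl fun i _ => hval f hf σ i], ← Matrix.det_apply]
  -- (D) `det H_f = (Π κ_{f i}) · det (Newton matrix at the nodes z^f)` and the cross-class Vandermonde
  have hnodes : ∀ (k i : Fin K), H f k i = (if toricWRank b i = 1 then coeff (f i) u * ((idet q (f i) : ℤ) : ℂ) else 1) *
      toricWNewt (toricWNodes b (toricWZ u v b f) (b i)) k (toricWRank b i) := by
    intro k i
    simp only [hH, Matrix.of_apply]
    rcases hr01 i with h0 | h1
    · rw [if_neg (by omega), if_neg (by omega), one_mul, h0, toricWNewt_zero_right, ← h0, toricWNodes_rank]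
      unfold toricWZ; rw [if_neg (by omega), add_zero]
    · rw [if_pos h1, if_pos h1, h1]
      unfold toricWLead
      rw [pow_one]
      congr 1
      refine toricWNewt_congr _ _ fun t ht => ?_
      obtain ⟨j, hji, hbj, hrj, hn0⟩ := toricWNodes_zero_of_rank_one b (toricWZ u v b f) i h1
      interval_cases t
      · rw [hn0]; unfold toricWZ; rw [if_neg (by omega), hbj]; simp
      · have hn1 := toricWNodes_rank b (toricWZ u v b f) i
        rw [h1] at hn1
        rw [hn1]; unfold toricWZ; rw [if_pos h1]; simp
  have hHmat : H f = Matrix.of fun k i => (if toricWRank b i = 1 then coeff (f i) u * ((idet q (f i) : ℤ) : ℂ) else 1) *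
      (Matrix.of fun (k i : Fin K) => toricWNewt (toricWNodes b (toricWZ u v b f) (b i)) (k : ℕ) (toricWRank b i)) k i := by
    ext k i; rw [hnodes, Matrix.of_apply, Matrix.of_apply]
  rw [hHmat, Matrix.det_mul_row, det_toricWNewt_nodes b (toricWZ u v b f) fun i j hji hbj => ?_]
  · congr 1
    rw [← Finset.prod_filter_mul_prod_filter_not Finset.univ (fun j => toricWRank b j = 1), ← hR1]
    rw [Finset.prod_congr rfl (fun i hi => if_pos (Finset.mem_filter.mp hi).2),
      Finset.prod_eq_one (fun i hi => if_neg (Finset.mem_filter.mp hi).2), mul_one]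
  · -- in-class injectivity of the nodes: `z_j = β`, `z_i = β + γ_{f i}` with `γ_{f i} ≠ 0`
    have hri : toricWRank b i = 1 := by have := toricWRank_lt_of_lt b hji hbj; have := hrank i; omega
    have hrj : toricWRank b j = 0 := by have := toricWRank_lt_of_lt b hji hbj; rw [hri] at this; omega
    obtain ⟨-, -, hfv⟩ := hfl f hf i hri
    unfold toricWZ
    rw [if_neg (by omega), if_pos hri, hbj, add_zero]
    intro h
    have : coeff v u * ((idet (f i) v : ℤ) : ℂ) = 0 := by linear_combination -h
    rcases mul_eq_zero.mp this with h' | h'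
    · exact huv h'
    · exact hfv (by exact_mod_cast h')

end TowerKernel

end Summit.ValiantsHypothesis.ValiantsHypothesis.Theorems.TwoProducts.RankTwoJacobian

end
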